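import Mathlib

/-!
# LangWeilTransfer, support item `TameResolution` (stmt-ValiantsHypothesis-6378) — Bézout
# relation between an irreducible polynomial and its derivative over a characteristic-`0` UFD

Route `LangWeilTransfer` of `ValiantsHypothesis` (conditional route; honest framing: bookkeeping,
nothing here bears on VP ≠ VNP). Step (P) of the architecture note of val-lit-p6 g9 inverts
`∂_U q (T̄, c, u)` modulo `q` with a denominator in `ℤ[T, Λ]`: for an irreducible `q` of positive
degree over the UFD `R = ℤ[T][Λ]` the resultant `Res_U(q, q') ∈ R` is non-zero and
`A q + B q' = Res` with `A, B ∈ R[U]`.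

* `isPrimitive_of_irreducible` — an irreducible polynomial of positive degree over a domain is
  primitive;
* `resultant_derivative_ne_zero` — `Res(q, q') ≠ 0` (Gauss: `q` stays irreducible over `Frac R`,
  hence separable in characteristic `0`, and `resultant_eq_zero_iff`);
* `exists_bezout_derivative` — `∃ A B, A q + B q' = C (Res(q, q'))`, `deg B < deg q`,
  `deg A < deg q'` (Mathlib `exists_mul_add_mul_eq_C_resultant`).
-/

noncomputable section

open Polynomial

-- the summit and the problem share the name `ValiantsHypothesis` (D-0017 single-conjunct layout)
set_option linter.dupNamespace false

namespace Summit.ValiantsHypothesis.ValiantsHypothesis.Theorems.LangWeilTransfer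

variable {R : Type*} [CommRing R] [IsDomain R]

/-- An irreducible polynomial of positive degree over an integral domain is primitive. -/
theorem isPrimitive_of_irreducible {q : R[X]} (hq : Irreducible q) (hdeg : 0 < q.natDegree) :
    q.IsPrimitive := by
  intro r hr
  obtain ⟨s, hs⟩ := hr
  rcases hq.isUnit_or_isUnit hs with h | h
  · exact Polynomial.isUnit_C.1 h
  · exfalso
    have hs0 : s.natDegree = 0 := Polynomial.natDegree_eq_zero_of_isUnit h
    have : q.natDegree = 0 := by
      rw [hs, Polynomial.natDegree_C_mul, hs0]
      rintro rfl
      rw [map_zero, zero_mul] at hs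
      exact hq.ne_zero hs
    omega

variable [UniqueFactorizationMonoid R] [CharZero R]

/-- **`Res(q, q') ≠ 0`** for an irreducible `q` of positive degree over a characteristic-`0` UFD. -/
theorem resultant_derivative_ne_zero {q : R[X]} (hq : Irreducible q) (hdeg : 0 < q.natDegree) :
    Polynomial.resultant q (derivative q) q.natDegree (derivative q).natDegree ≠ 0 := by
  classical
  let K := FractionRing R
  haveI : CharZero K := charZero_of_injective_algebraMap (IsFractionRing.injective R K)
  have hprim : q.IsPrimitive := isPrimitive_of_irreducible hq hdeg
  have hirrK : Irreducible (q.map (algebraMap R K)) :=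
    (hprim.irreducible_iff_irreducible_map_fraction_map (K := K)).1 hq
  have hsep : (q.map (algebraMap R K)).Separable := hirrK.separable
  have hcop : IsCoprime (q.map (algebraMap R K)) (derivative (q.map (algebraMap R K))) := hsep
  intro h0
  have hinj : Function.Injective (algebraMap R K) := IsFractionRing.injective R K
  have hK : Polynomial.resultant (q.map (algebraMap R K)) ((derivative q).map (algebraMap R K))
      q.natDegree (derivative q).natDegree = 0 := by
    rw [Polynomial.resultant_map_map, h0, map_zero]
  have hdq : (q.map (algebraMap R K)).natDegree = q.natDegree := Polynomial.natDegree_map_eq_of_injective hinj q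
  have hdq' : ((derivative q).map (algebraMap R K)).natDegree = (derivative q).natDegree :=
    Polynomial.natDegree_map_eq_of_injective hinj _
  rw [← hdq, ← hdq'] at hK
  have h := (Polynomial.resultant_eq_zero_iff.1 hK).2
  rw [Polynomial.derivative_map] at hcop
  exact h hcop

/-- **Bézout relation with the derivative.** For an irreducible `q` of positive degree over a
characteristic-`0` UFD there are `A, B ∈ R[U]` with `A q + B q' = Res(q, q') ∈ R ∖ 0`, `deg A < deg q'`,
`deg B < deg q`. -/
theorem exists_bezout_derivative {q : R[X]} (hq : Irreducible q) (hdeg : 0 < q.natDegree) :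
    ∃ (c : R) (A B : R[X]), c ≠ 0 ∧ A.degree < ((derivative q).natDegree : WithBot ℕ) ∧
      B.degree < (q.natDegree : WithBot ℕ) ∧ A * q + B * derivative q = Polynomial.C c := by
  obtain ⟨A, B, hA, hB, hAB⟩ := Polynomial.exists_mul_add_mul_eq_C_resultant q (derivative q)
    le_rfl le_rfl (Or.inl (Nat.pos_iff_ne_zero.1 hdeg))
  refine ⟨_, A, B, resultant_derivative_ne_zero hq hdeg, hA, hB, ?_⟩
  rw [← hAB]; ring

end Summit.ValiantsHypothesis.ValiantsHypothesis.Theorems.LangWeilTransfer
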